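import Mathlib
import Summits.NavierStokesRegularity.FluidComputer.TransportGalerkinUniqueLimit
import Summits.NavierStokesRegularity.FluidComputer.TransportGalerkinAbcSolution
import HarnessLib

/-!
# Galerkin limit of the transport model, XXIV: the forced-ABC KEEP word about THE SMOOTH solution, unique among ALL spatially smooth classical solutions (instab g20, cell `ns-blowup`, 2026-08-27)

HONEST FRAMING (human ruling D-0035): nothing here is a claim about Navier–Stokes blow-up.
WHAT THIS IS NOT: not NS — a MODEL theorem schema about the forced-ABC perturbation equation on
`𝕋³`; its load-bearing inputs are the Lyapunov certificates of record (interval stage not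
commissioned) and, for KEEP, the certified X0 eigenvalue; no number or census word moves.

PURPOSE. The final form of the KEEP entry point for certificate holders. Compared with
`TransportGalerkinAbcSolution.exists_keep_solution_abc_final` (part XVIII: existence in the order-`6`
tail class, the floor, uniqueness in that class), THE solution is here also SMOOTH IN SPACE at every time
of the window (`RapidDecay ⇑(w t)`, part XIX) and UNIQUE AMONG ALL SPATIALLY SMOOTH CLASSICAL SOLUTIONS
keeping the three clauses on `(0, T)` — no tail uniformity asked of the competitor (parts XXI–XXII, the
weak–strong `L²` argument). Hypotheses unchanged: X0 row + certificate + gap/margin/window. The core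
`keep_smooth_of_eigenvector` takes the eigenvector as a hypothesis (eigen-consistency by
`TransportGalerkinEigen.tendsto_eigen_residual`). KILL twin: `TransportGalerkinAbcSmoothKill`. Mathlib +
the tree files cited; no new definitions.
-/

noncomputable section

open scoped ENNReal NNReal ComplexConjugate InnerProductSpace
open Set Filter Topology

namespace Summit.NavierStokesRegularity.FluidComputer.TransportGalerkinAbcSmoothKeep

open RCLike MeasureTheory UnitAddTorus
open Literature.Analysis.FunctionSpaces Literature.Analysis.FunctionSpaces.Lattice
open Literature.Analysis.FunctionSpaces.Torus Literature.Analysis.FunctionSpaces.EuclideanSpace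
open Literature.Analysis.ODE Literature.Analysis.FluidPDE
open Summit.NavierStokesRegularity.FluidComputer.TransportGalerkin
open Summit.NavierStokesRegularity.FluidComputer.TransportGalerkinBox
open Summit.NavierStokesRegularity.FluidComputer.TransportGalerkinEigen
open Summit.NavierStokesRegularity.FluidComputer.TransportGalerkinAbc
open Summit.NavierStokesRegularity.FluidComputer.TransportGalerkinAbcEigen
open Summit.NavierStokesRegularity.FluidComputer.TransportGalerkinInvariance
open Summit.NavierStokesRegularity.FluidComputer.TransportGalerkinLevelSubspace
open Summit.NavierStokesRegularity.FluidComputer.TransportGalerkinLevelExistence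
open Summit.NavierStokesRegularity.FluidComputer.TransportGalerkinEmergenceH2
open Summit.NavierStokesRegularity.FluidComputer.TransportGalerkinEmergenceLevels
open Summit.NavierStokesRegularity.FluidComputer.TransportGalerkinExistence
open Summit.NavierStokesRegularity.FluidComputer.TransportGalerkinSmooth
open Summit.NavierStokesRegularity.FluidComputer.TransportGalerkinUniqueLimit
open Summit.NavierStokesRegularity.FluidComputer.TransportGalerkinAbcFinal
open Summit.NavierStokesRegularity.FluidComputer.TransportGalerkinAbcSolution
open Summit.NavierStokesRegularity.FluidComputer.ConvectiveProductLawBooking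

/-- **KEEP core for a GIVEN eigenvector** (`keep_smooth_of_eigenvector`): for a unit, rapidly
decreasing, constrained exact eigenvector `v` (`linOp v = μ • v`, `μ ≥ 0`, `ν > 0`), the certificate at
levels `≥ K`, gap/margin/window: THE classical solution from `ε•v` on `[0, T]` exists, is smooth in space at
every `t`, lies in the order-`6` tail class with the clauses, and every spatially smooth classical solution
from `ε•v` keeping the clauses on `(0, T)` coincides with it. (The floor is added in
`exists_keep_solution_abc_smooth`.) -/
theorem keep_smooth_of_eigenvector (K : ℕ) (A B C : ℝ) {ν μ : ℝ} (hν : 0 < ν) (hμ : 0 ≤ μ)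
    {v : lp (fun _ : (Fin 3 → ℤ) => EuclideanSpace ℂ (Fin 3)) 2} (hv1 : ‖v‖ = 1) (hvr : RapidDecay (⇑v)) (hvP : ∀ k, lerayCLM k (v k) = v k)
    (hvreal : ∀ (j : Fin 3) (k : Fin 3 → ℤ), (EuclideanSpace.proj j : EuclideanSpace ℂ (Fin 3) →L[ℂ] ℂ) (v (-k)) =
      conj ((EuclideanSpace.proj j : EuclideanSpace ℂ (Fin 3) →L[ℂ] ℂ) (v k)))
    (hvdiv : ∀ k : Fin 3 → ℤ, ∑ j, ((k j : ℤ) : ℂ) * (EuclideanSpace.proj j : EuclideanSpace ℂ (Fin 3) →L[ℂ] ℂ) (v k) = 0)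
    (hAv : linOp ν (mFourierCoeff (complexify ∘ Torus.abcFlow A B C))
      (fun j => (EuclideanSpace.proj j : EuclideanSpace ℂ (Fin 3) →L[ℂ] ℂ)) lerayCLM v = μ • v)
    {T : ℝ} (hT : 0 ≤ T) {ε : ℝ} (hε : 0 < ε)
    {μt : ℝ}
    {G₁ G₂ G : lp (fun _ : (Fin 3 → ℤ) => EuclideanSpace ℂ (Fin 3)) 2 →L[ℝ]
      lp (fun _ : (Fin 3 → ℤ) => EuclideanSpace ℂ (Fin 3)) 2}
    (hG₁ : ∀ x y : lp (fun _ : (Fin 3 → ℤ) => EuclideanSpace ℂ (Fin 3)) 2, ⟪G₁ x, y⟫_ℂ = ⟪x, G₁ y⟫_ℂ)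
    (hG₂ : ∀ x y : lp (fun _ : (Fin 3 → ℤ) => EuclideanSpace ℂ (Fin 3)) 2, ⟪G₂ x, y⟫_ℂ = ⟪x, G₂ y⟫_ℂ)
    (hG : ∀ x y : lp (fun _ : (Fin 3 → ℤ) => EuclideanSpace ℂ (Fin 3)) 2, ⟪G x, y⟫_ℂ = ⟪x, G y⟫_ℂ)
    (hG₁P : ∀ n, ∀ w z : lp (fun _ : (Fin 3 → ℤ) => EuclideanSpace ℂ (Fin 3)) 2,
      ⟪G₁ w, cubeProj (n + K) z⟫_ℂ = ⟪G₁ (cubeProj (n + K) w), z⟫_ℂ)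
    (hG₂P : ∀ n, ∀ w z : lp (fun _ : (Fin 3 → ℤ) => EuclideanSpace ℂ (Fin 3)) 2,
      ⟪G₂ w, cubeProj (n + K) z⟫_ℂ = ⟪G₂ (cubeProj (n + K) w), z⟫_ℂ)
    (hGP : ∀ n, ∀ w z : lp (fun _ : (Fin 3 → ℤ) => EuclideanSpace ℂ (Fin 3)) 2,
      ⟪G w, cubeProj (n + K) z⟫_ℂ = ⟪G (cubeProj (n + K) w), z⟫_ℂ)
    (hG₁pos : ∀ x : lp (fun _ : (Fin 3 → ℤ) => EuclideanSpace ℂ (Fin 3)) 2, 0 ≤ re ⟪G₁ x, x⟫_ℂ)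
    {ω c m₂ M₁ : ℝ} (hc : 0 < c) (hm₂ : 0 < m₂) (hM₁ : 0 ≤ M₁)
    (hm₂' : ∀ x : lp (fun _ : (Fin 3 → ℤ) => EuclideanSpace ℂ (Fin 3)) 2, m₂ * ‖x‖ ^ 2 ≤ re ⟪G₂ x, x⟫_ℂ)
    (hM₁' : ∀ x : lp (fun _ : (Fin 3 → ℤ) => EuclideanSpace ℂ (Fin 3)) 2,
      re ⟪G₁ x, x⟫_ℂ ≤ M₁ * (eNormSq (-1) (⇑x)).toReal)
    {m M ω₁ : ℝ} (hm0 : 0 < m)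
    (hm : ∀ x : lp (fun _ : (Fin 3 → ℤ) => EuclideanSpace ℂ (Fin 3)) 2, m * ‖x‖ ^ 2 ≤ re ⟪G x, x⟫_ℂ)
    (hM : ∀ x : lp (fun _ : (Fin 3 → ℤ) => EuclideanSpace ℂ (Fin 3)) 2, re ⟪G x, x⟫_ℂ ≤ M * ‖x‖ ^ 2)
    (h₁ : ∀ n, ∀ w : lp (fun _ : (Fin 3 → ℤ) => EuclideanSpace ℂ (Fin 3)) 2,
      2 * re ⟪G₁ (cubeProj (n + K) w), linOp ν (mFourierCoeff (EuclideanSpace.complexify ∘ Torus.abcFlow A B C))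
        (fun j => (EuclideanSpace.proj j : EuclideanSpace ℂ (Fin 3) →L[ℂ] ℂ)) lerayCLM (cubeProj (n + K) w)⟫_ℂ +
        c * re ⟪G₂ (cubeProj (n + K) w), cubeProj (n + K) w⟫_ℂ ≤ 2 * ω * re ⟪G₁ (cubeProj (n + K) w), cubeProj (n + K) w⟫_ℂ)
    (h₂ : ∀ n, ∀ w : lp (fun _ : (Fin 3 → ℤ) => EuclideanSpace ℂ (Fin 3)) 2,
      re ⟪G₂ (cubeProj (n + K) w), linOp ν (mFourierCoeff (EuclideanSpace.complexify ∘ Torus.abcFlow A B C))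
        (fun j => (EuclideanSpace.proj j : EuclideanSpace ℂ (Fin 3) →L[ℂ] ℂ)) lerayCLM (cubeProj (n + K) w)⟫_ℂ ≤
        ω * re ⟪G₂ (cubeProj (n + K) w), cubeProj (n + K) w⟫_ℂ)
    (hL : ∀ n, ∀ w : lp (fun _ : (Fin 3 → ℤ) => EuclideanSpace ℂ (Fin 3)) 2,
      re ⟪G (cubeProj (n + K) w), linOp ν (mFourierCoeff (EuclideanSpace.complexify ∘ Torus.abcFlow A B C))
        (fun j => (EuclideanSpace.proj j : EuclideanSpace ℂ (Fin 3) →L[ℂ] ℂ)) lerayCLM (cubeProj (n + K) w)⟫_ℂ ≤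
        ω₁ * re ⟪G (cubeProj (n + K) w), cubeProj (n + K) w⟫_ℂ)
    (hμ₁ : μt ≤ ω₁) (hμ₂ : μt ≤ ω)
    (htail : ∀ n, ∀ q : lp (fun _ : (Fin 3 → ℤ) => EuclideanSpace ℂ (Fin 3)) 2, cubeProj (n + K) q = 0 →
      2 * μt * re ⟪G₁ q, q⟫_ℂ + c * re ⟪G₂ q, q⟫_ℂ ≤ 2 * ω * re ⟪G₁ q, q⟫_ℂ)
    (hgap : ω < 2 * μ)
    {C' : ℝ}
    (hCC' : Real.sqrt (M₁ / (c * m₂)) * (2 * ((Fintype.card (Fin 3) : ℝ) * (2 * Real.pi)) *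
        Real.sqrt ((∑' l : Fin 3 → ℤ, ENNReal.ofReal (sobolevWeight (-2) l ^ 2)).toReal)) *
        Real.sqrt (Real.pi / (2 * μ - ω)) < C')
    (hsmall : ∀ t ∈ Icc 0 T, C' * (3 / 2 : ℝ) ^ 2 * (ε * Real.exp (μ * t)) < 3 / 2 - 1) :
    ∃ w : ℝ → lp (fun _ : (Fin 3 → ℤ) => EuclideanSpace ℂ (Fin 3)) 2,
      ContinuousOn w (Icc 0 T) ∧ w 0 = ε • v ∧
      (∀ t ∈ Ioo 0 T, HasDerivAt w (nsField ν (mFourierCoeff (EuclideanSpace.complexify ∘ Torus.abcFlow A B C))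
            (fun j => (EuclideanSpace.proj j : EuclideanSpace ℂ (Fin 3) →L[ℂ] ℂ)) lerayCLM (w t)) t) ∧
      (∀ t ∈ Icc 0 T, RapidDecay (⇑(w t))) ∧
      (∃ Cw : ℝ, 0 ≤ Cw ∧ ∀ t ∈ Icc 0 T, ∀ k, ‖(w t : (Fin 3 → ℤ) → EuclideanSpace ℂ (Fin 3)) k‖ ≤
        Cw * sobolevWeight (-((Fintype.card (Fin 3) : ℝ) + 3)) k) ∧
      (∀ t ∈ Icc 0 T, ∀ k, lerayCLM k ((w t : (Fin 3 → ℤ) → EuclideanSpace ℂ (Fin 3)) k) =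
        (w t : (Fin 3 → ℤ) → EuclideanSpace ℂ (Fin 3)) k) ∧
      (∀ t ∈ Icc 0 T, ∀ (j : Fin 3) (k : Fin 3 → ℤ),
        (EuclideanSpace.proj j : EuclideanSpace ℂ (Fin 3) →L[ℂ] ℂ) ((w t : (Fin 3 → ℤ) → EuclideanSpace ℂ (Fin 3)) (-k)) =
          conj ((EuclideanSpace.proj j : EuclideanSpace ℂ (Fin 3) →L[ℂ] ℂ) ((w t : (Fin 3 → ℤ) → EuclideanSpace ℂ (Fin 3)) k))) ∧
      (∀ t ∈ Icc 0 T, ∀ k : Fin 3 → ℤ,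
        ∑ j, ((k j : ℤ) : ℂ) * (EuclideanSpace.proj j : EuclideanSpace ℂ (Fin 3) →L[ℂ] ℂ)
          ((w t : (Fin 3 → ℤ) → EuclideanSpace ℂ (Fin 3)) k) = 0) ∧
      -- uniqueness among ALL spatially smooth classical solutions keeping the clauses
      ∀ {w' : ℝ → lp (fun _ : (Fin 3 → ℤ) => EuclideanSpace ℂ (Fin 3)) 2} (_hw' : ContinuousOn w' (Icc 0 T))
        (_hw'0 : w' 0 = ε • v)
        (_hw'' : ∀ t ∈ Ioo 0 T, HasDerivAt w' (nsField ν (mFourierCoeff (EuclideanSpace.complexify ∘ Torus.abcFlow A B C))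
            (fun j => (EuclideanSpace.proj j : EuclideanSpace ℂ (Fin 3) →L[ℂ] ℂ)) lerayCLM (w' t)) t)
        (_hw'r : ∀ t ∈ Ioo 0 T, RapidDecay (⇑(w' t)))
        (_hw'fix : ∀ t ∈ Ioo 0 T, ∀ k, lerayCLM k ((w' t : (Fin 3 → ℤ) → EuclideanSpace ℂ (Fin 3)) k) =
          (w' t : (Fin 3 → ℤ) → EuclideanSpace ℂ (Fin 3)) k)
        (_hw'real : ∀ t ∈ Ioo 0 T, ∀ (j : Fin 3) (k : Fin 3 → ℤ),
          (EuclideanSpace.proj j : EuclideanSpace ℂ (Fin 3) →L[ℂ] ℂ) ((w' t : (Fin 3 → ℤ) → EuclideanSpace ℂ (Fin 3)) (-k)) =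
            conj ((EuclideanSpace.proj j : EuclideanSpace ℂ (Fin 3) →L[ℂ] ℂ) ((w' t : (Fin 3 → ℤ) → EuclideanSpace ℂ (Fin 3)) k)))
        (_hw'div : ∀ t ∈ Ioo 0 T, ∀ k : Fin 3 → ℤ,
          ∑ j, ((k j : ℤ) : ℂ) * (EuclideanSpace.proj j : EuclideanSpace ℂ (Fin 3) →L[ℂ] ℂ)
            ((w' t : (Fin 3 → ℤ) → EuclideanSpace ℂ (Fin 3)) k) = 0),
        EqOn w' w (Icc 0 T) := by
  have hres := tendsto_eigen_residual (ν := ν) (rapidDecay_abcHost A B C) TransportGalerkinAbc.norm_proj_le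
    norm_lerayCLM_le hvr hAv
  -- the Galerkin levels of the seed and the chain's own `H²` bound
  have hUreal : IsConjSymm (mFourierCoeff (EuclideanSpace.complexify ∘ Torus.abcFlow A B C)) :=
    (isConjSymm_iff_proj _).2 (abcHost_real A B C)
  have hsol := fun n => exists_level_solution (ν := ν) hν.le (rapidDecay_abcHost A B C) hUreal (abcHost_div A B C)
    (n + K) (cubeProj_smul_mem_levelSubspace hvP hvreal hvdiv ε (n + K))
  choose u hu0 hu' hucont humem using hsol
  have sc : ∀ n, ContinuousOn (u n) (Icc 0 T) := fun n t ht => (hu' n T t ht).continuousWithinAt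
  have sd : ∀ n, ∀ t ∈ Icc 0 T, HasDerivWithinAt (u n) (cubeProj (n + K) (nsField ν (mFourierCoeff (EuclideanSpace.complexify ∘ Torus.abcFlow A B C))
        (fun j => (EuclideanSpace.proj j : EuclideanSpace ℂ (Fin 3) →L[ℂ] ℂ)) lerayCLM (u n t))) (Icc 0 T) t :=
    fun n t ht => hu' n T t ht
  have sp : ∀ n, ∀ t ∈ Icc 0 T, cubeProj (n + K) (u n t) = u n t := fun n t _ => (humem n t).1
  have sf : ∀ n, ∀ t ∈ Icc 0 T, ∀ k, lerayCLM k ((u n t : (Fin 3 → ℤ) → EuclideanSpace ℂ (Fin 3)) k) =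
      (u n t : (Fin 3 → ℤ) → EuclideanSpace ℂ (Fin 3)) k := fun n t _ => (humem n t).2.1
  have sr : ∀ n, ∀ t ∈ Icc 0 T, ∀ (j : Fin 3) (k : Fin 3 → ℤ),
      (EuclideanSpace.proj j : EuclideanSpace ℂ (Fin 3) →L[ℂ] ℂ) ((u n t : (Fin 3 → ℤ) → EuclideanSpace ℂ (Fin 3)) (-k)) =
        conj ((EuclideanSpace.proj j : EuclideanSpace ℂ (Fin 3) →L[ℂ] ℂ) ((u n t : (Fin 3 → ℤ) → EuclideanSpace ℂ (Fin 3)) k)) :=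
    fun n t _ => (humem n t).2.2.1
  have sv : ∀ n, ∀ t ∈ Icc 0 T, ∀ k : Fin 3 → ℤ,
      ∑ j, ((k j : ℤ) : ℂ) * (EuclideanSpace.proj j : EuclideanSpace ℂ (Fin 3) →L[ℂ] ℂ)
        ((u n t : (Fin 3 → ℤ) → EuclideanSpace ℂ (Fin 3)) k) = 0 := fun n t _ => (humem n t).2.2.2
  obtain ⟨r, hr, hbound⟩ := exists_levelBound K (rapidDecay_abcHost A B C) TransportGalerkinAbc.norm_proj_le
    norm_lerayCLM_le (tsum_sobolevWeight_neg_two_sq_lt_top (Fintype.card_fin 3).le) hv1 hμ hε (u := u)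
    sc (fun n => hu0 n) sd (fun n => hucont n T) sp
    hG₁ hG₂ hG hG₁P hG₂P hGP hG₁pos hc hm₂ hM₁ hm₂' hM₁' hm0 hm hM h₁ h₂ hL hμ₁ hμ₂ htail hgap
    (hres.comp (tendsto_add_atTop_nat K)) hCC' hsmall
  have hzr : RapidDecay (⇑(ε • v)) := rapidDecay_coe_smul hvr ε
  have hzW := mem_box.1 (smul_mem_box (P := lerayCLM) hvP hvreal hvdiv (ε := ε) fun k => le_rfl)
  -- THE solution, its smoothness, uniqueness among smooth solutions
  obtain ⟨w, hconv, hw, hw0, hw', ⟨Cw, hCw, hwdec⟩, hwfix, hwreal, hwdiv⟩ :=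
    exists_solution_of_levelBound K hν (rapidDecay_abcHost A B C) (abcHost_real A B C) (abcHost_div A B C)
      TransportGalerkinAbc.norm_proj_le isSelfAdjoint_lerayCLM norm_lerayCLM_le
      (tsum_sobolevWeight_neg_two_sq_lt_top (Fintype.card_fin 3).le) hT hzr hzW.2.1 hzW.2.2.1 hzW.2.2.2 hr
      (u := u) sc (fun n => hu0 n) sd sp sf sr sv hbound
  have hsmooth := (smooth_of_tendstoUniformlyOn K hν (rapidDecay_abcHost A B C) (abcHost_real A B C) (abcHost_div A B C)
      TransportGalerkinAbc.norm_proj_le isSelfAdjoint_lerayCLM norm_lerayCLM_le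
      (tsum_sobolevWeight_neg_two_sq_lt_top (Fintype.card_fin 3).le) hzr hr
      (u := u) sc (fun n => hu0 n) sd sp sf sr sv hbound hconv).2
  refine ⟨w, hw, hw0, hw', hsmooth, ⟨Cw, hCw, hwdec⟩, hwfix, hwreal, hwdiv, ?_⟩
  intro w' hw'c hw'0 hw'' hw'r hw'fix hw'real hw'div
  have h : TendstoUniformlyOn (fun n t => u n t) w' atTop (Icc 0 T) :=
    tendstoUniformlyOn_of_smooth_solution K hν (rapidDecay_abcHost A B C) (abcHost_real A B C) (abcHost_div A B C)
      TransportGalerkinAbc.norm_proj_le isSelfAdjoint_lerayCLM norm_lerayCLM_le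
      (tsum_sobolevWeight_neg_two_sq_lt_top (Fintype.card_fin 3).le) hT hzr hzW.2.1 hzW.2.2.1 hzW.2.2.2 hr
    (u := u) sc (fun n => hu0 n) sd sp sf sr sv hbound hw'c hw'0 hw'' hw'r hw'fix hw'real hw'div
  exact eqOn_of_two_uniform_limits h hconv

/-- **KEEP about THE smooth solution** (`exists_keep_solution_abc_smooth`): X0 row (`μ ≥ 0`, `ν > 0`)
+ certificate + gap/margin/window ⟹ THE classical solution from `ε•v` on `[0, T]` exists, is smooth in
space at every `t`, obeys the floor `ε e^{μt}/2 ≤ ‖w t‖` while `ε e^{μt} ≤ 2/(9C')`, and every spatially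
smooth classical solution from `ε•v` keeping the clauses on `(0, T)` coincides with it on `[0, T]`. -/
theorem exists_keep_solution_abc_smooth (K : ℕ) (A B C : ℝ) {ν μ : ℝ} (hν : 0 < ν) (hμ : 0 ≤ μ)
    (heig : Torus.IsLinNSEigenvalue ν (Torus.abcFlow A B C) (μ : ℂ)) :
    ∃ v : lp (fun _ : (Fin 3 → ℤ) => EuclideanSpace ℂ (Fin 3)) 2,
      ‖v‖ = 1 ∧ RapidDecay (⇑v) ∧ (∀ k, lerayCLM k (v k) = v k) ∧
      (∀ (j : Fin 3) (k : Fin 3 → ℤ), (EuclideanSpace.proj j : EuclideanSpace ℂ (Fin 3) →L[ℂ] ℂ) (v (-k)) =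
        conj ((EuclideanSpace.proj j : EuclideanSpace ℂ (Fin 3) →L[ℂ] ℂ) (v k))) ∧
      (∀ k : Fin 3 → ℤ, ∑ j, ((k j : ℤ) : ℂ) * (EuclideanSpace.proj j : EuclideanSpace ℂ (Fin 3) →L[ℂ] ℂ) (v k) = 0) ∧
      linOp ν (mFourierCoeff (complexify ∘ Torus.abcFlow A B C))
          (fun j => (EuclideanSpace.proj j : EuclideanSpace ℂ (Fin 3) →L[ℂ] ℂ)) lerayCLM v = μ • v ∧
      ∀ {T : ℝ} (hT : 0 ≤ T) {ε : ℝ} (hε : 0 < ε)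
        {μt : ℝ}
        {G₁ G₂ G : lp (fun _ : (Fin 3 → ℤ) => EuclideanSpace ℂ (Fin 3)) 2 →L[ℝ]
          lp (fun _ : (Fin 3 → ℤ) => EuclideanSpace ℂ (Fin 3)) 2}
        (hG₁ : ∀ x y : lp (fun _ : (Fin 3 → ℤ) => EuclideanSpace ℂ (Fin 3)) 2, ⟪G₁ x, y⟫_ℂ = ⟪x, G₁ y⟫_ℂ)
        (hG₂ : ∀ x y : lp (fun _ : (Fin 3 → ℤ) => EuclideanSpace ℂ (Fin 3)) 2, ⟪G₂ x, y⟫_ℂ = ⟪x, G₂ y⟫_ℂ)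
        (hG : ∀ x y : lp (fun _ : (Fin 3 → ℤ) => EuclideanSpace ℂ (Fin 3)) 2, ⟪G x, y⟫_ℂ = ⟪x, G y⟫_ℂ)
        (hG₁P : ∀ n, ∀ w z : lp (fun _ : (Fin 3 → ℤ) => EuclideanSpace ℂ (Fin 3)) 2,
          ⟪G₁ w, cubeProj (n + K) z⟫_ℂ = ⟪G₁ (cubeProj (n + K) w), z⟫_ℂ)
        (hG₂P : ∀ n, ∀ w z : lp (fun _ : (Fin 3 → ℤ) => EuclideanSpace ℂ (Fin 3)) 2,
          ⟪G₂ w, cubeProj (n + K) z⟫_ℂ = ⟪G₂ (cubeProj (n + K) w), z⟫_ℂ)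
        (hGP : ∀ n, ∀ w z : lp (fun _ : (Fin 3 → ℤ) => EuclideanSpace ℂ (Fin 3)) 2,
          ⟪G w, cubeProj (n + K) z⟫_ℂ = ⟪G (cubeProj (n + K) w), z⟫_ℂ)
        (hG₁pos : ∀ x : lp (fun _ : (Fin 3 → ℤ) => EuclideanSpace ℂ (Fin 3)) 2, 0 ≤ re ⟪G₁ x, x⟫_ℂ)
        {ω c m₂ M₁ : ℝ} (hc : 0 < c) (hm₂ : 0 < m₂) (hM₁ : 0 ≤ M₁)
        (hm₂' : ∀ x : lp (fun _ : (Fin 3 → ℤ) => EuclideanSpace ℂ (Fin 3)) 2, m₂ * ‖x‖ ^ 2 ≤ re ⟪G₂ x, x⟫_ℂ)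
        (hM₁' : ∀ x : lp (fun _ : (Fin 3 → ℤ) => EuclideanSpace ℂ (Fin 3)) 2,
          re ⟪G₁ x, x⟫_ℂ ≤ M₁ * (eNormSq (-1) (⇑x)).toReal)
        {m M ω₁ : ℝ} (hm0 : 0 < m)
        (hm : ∀ x : lp (fun _ : (Fin 3 → ℤ) => EuclideanSpace ℂ (Fin 3)) 2, m * ‖x‖ ^ 2 ≤ re ⟪G x, x⟫_ℂ)
        (hM : ∀ x : lp (fun _ : (Fin 3 → ℤ) => EuclideanSpace ℂ (Fin 3)) 2, re ⟪G x, x⟫_ℂ ≤ M * ‖x‖ ^ 2)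
        (h₁ : ∀ n, ∀ w : lp (fun _ : (Fin 3 → ℤ) => EuclideanSpace ℂ (Fin 3)) 2,
          2 * re ⟪G₁ (cubeProj (n + K) w), linOp ν (mFourierCoeff (EuclideanSpace.complexify ∘ Torus.abcFlow A B C))
            (fun j => (EuclideanSpace.proj j : EuclideanSpace ℂ (Fin 3) →L[ℂ] ℂ)) lerayCLM (cubeProj (n + K) w)⟫_ℂ +
            c * re ⟪G₂ (cubeProj (n + K) w), cubeProj (n + K) w⟫_ℂ ≤ 2 * ω * re ⟪G₁ (cubeProj (n + K) w), cubeProj (n + K) w⟫_ℂ)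
        (h₂ : ∀ n, ∀ w : lp (fun _ : (Fin 3 → ℤ) => EuclideanSpace ℂ (Fin 3)) 2,
          re ⟪G₂ (cubeProj (n + K) w), linOp ν (mFourierCoeff (EuclideanSpace.complexify ∘ Torus.abcFlow A B C))
            (fun j => (EuclideanSpace.proj j : EuclideanSpace ℂ (Fin 3) →L[ℂ] ℂ)) lerayCLM (cubeProj (n + K) w)⟫_ℂ ≤
            ω * re ⟪G₂ (cubeProj (n + K) w), cubeProj (n + K) w⟫_ℂ)
        (hL : ∀ n, ∀ w : lp (fun _ : (Fin 3 → ℤ) => EuclideanSpace ℂ (Fin 3)) 2,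
          re ⟪G (cubeProj (n + K) w), linOp ν (mFourierCoeff (EuclideanSpace.complexify ∘ Torus.abcFlow A B C))
            (fun j => (EuclideanSpace.proj j : EuclideanSpace ℂ (Fin 3) →L[ℂ] ℂ)) lerayCLM (cubeProj (n + K) w)⟫_ℂ ≤
            ω₁ * re ⟪G (cubeProj (n + K) w), cubeProj (n + K) w⟫_ℂ)
        (hμ₁ : μt ≤ ω₁) (hμ₂ : μt ≤ ω)
        (htail : ∀ n, ∀ q : lp (fun _ : (Fin 3 → ℤ) => EuclideanSpace ℂ (Fin 3)) 2, cubeProj (n + K) q = 0 →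
          2 * μt * re ⟪G₁ q, q⟫_ℂ + c * re ⟪G₂ q, q⟫_ℂ ≤ 2 * ω * re ⟪G₁ q, q⟫_ℂ)
        (hgap : ω < 2 * μ)
        {C' : ℝ}
        (hCC' : Real.sqrt (M₁ / (c * m₂)) * (2 * ((Fintype.card (Fin 3) : ℝ) * (2 * Real.pi)) *
            Real.sqrt ((∑' l : Fin 3 → ℤ, ENNReal.ofReal (sobolevWeight (-2) l ^ 2)).toReal)) *
            Real.sqrt (Real.pi / (2 * μ - ω)) < C')
        (hsmall : ∀ t ∈ Icc 0 T, C' * (3 / 2 : ℝ) ^ 2 * (ε * Real.exp (μ * t)) < 3 / 2 - 1),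
        -- THE smooth solution: existence, smoothness, the floor, uniqueness among smooth solutions
        ∃ w : ℝ → lp (fun _ : (Fin 3 → ℤ) => EuclideanSpace ℂ (Fin 3)) 2,
          ContinuousOn w (Icc 0 T) ∧ w 0 = ε • v ∧
          (∀ t ∈ Ioo 0 T, HasDerivAt w (nsField ν (mFourierCoeff (EuclideanSpace.complexify ∘ Torus.abcFlow A B C))
            (fun j => (EuclideanSpace.proj j : EuclideanSpace ℂ (Fin 3) →L[ℂ] ℂ)) lerayCLM (w t)) t) ∧
          (∀ t ∈ Icc 0 T, RapidDecay (⇑(w t))) ∧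
          (∃ Cw : ℝ, 0 ≤ Cw ∧ ∀ t ∈ Icc 0 T, ∀ k, ‖(w t : (Fin 3 → ℤ) → EuclideanSpace ℂ (Fin 3)) k‖ ≤
            Cw * sobolevWeight (-((Fintype.card (Fin 3) : ℝ) + 3)) k) ∧
          (∀ t ∈ Icc 0 T, ∀ k, lerayCLM k ((w t : (Fin 3 → ℤ) → EuclideanSpace ℂ (Fin 3)) k) =
            (w t : (Fin 3 → ℤ) → EuclideanSpace ℂ (Fin 3)) k) ∧
          (∀ t ∈ Icc 0 T, ∀ (j : Fin 3) (k : Fin 3 → ℤ),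
            (EuclideanSpace.proj j : EuclideanSpace ℂ (Fin 3) →L[ℂ] ℂ) ((w t : (Fin 3 → ℤ) → EuclideanSpace ℂ (Fin 3)) (-k)) =
              conj ((EuclideanSpace.proj j : EuclideanSpace ℂ (Fin 3) →L[ℂ] ℂ) ((w t : (Fin 3 → ℤ) → EuclideanSpace ℂ (Fin 3)) k))) ∧
          (∀ t ∈ Icc 0 T, ∀ k : Fin 3 → ℤ,
            ∑ j, ((k j : ℤ) : ℂ) * (EuclideanSpace.proj j : EuclideanSpace ℂ (Fin 3) →L[ℂ] ℂ)
              ((w t : (Fin 3 → ℤ) → EuclideanSpace ℂ (Fin 3)) k) = 0) ∧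
          (∀ t ∈ Icc 0 T, ε * Real.exp (μ * t) ≤ 2 / (9 * C') → ε * Real.exp (μ * t) / 2 ≤ ‖w t‖) ∧
          -- uniqueness among ALL spatially smooth classical solutions keeping the clauses
          ∀ {w' : ℝ → lp (fun _ : (Fin 3 → ℤ) => EuclideanSpace ℂ (Fin 3)) 2} (_hw' : ContinuousOn w' (Icc 0 T))
            (_hw'0 : w' 0 = ε • v)
            (_hw'' : ∀ t ∈ Ioo 0 T, HasDerivAt w' (nsField ν (mFourierCoeff (EuclideanSpace.complexify ∘ Torus.abcFlow A B C))
            (fun j => (EuclideanSpace.proj j : EuclideanSpace ℂ (Fin 3) →L[ℂ] ℂ)) lerayCLM (w' t)) t)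
            (_hw'r : ∀ t ∈ Ioo 0 T, RapidDecay (⇑(w' t)))
            (_hw'fix : ∀ t ∈ Ioo 0 T, ∀ k, lerayCLM k ((w' t : (Fin 3 → ℤ) → EuclideanSpace ℂ (Fin 3)) k) =
              (w' t : (Fin 3 → ℤ) → EuclideanSpace ℂ (Fin 3)) k)
            (_hw'real : ∀ t ∈ Ioo 0 T, ∀ (j : Fin 3) (k : Fin 3 → ℤ),
              (EuclideanSpace.proj j : EuclideanSpace ℂ (Fin 3) →L[ℂ] ℂ) ((w' t : (Fin 3 → ℤ) → EuclideanSpace ℂ (Fin 3)) (-k)) =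
                conj ((EuclideanSpace.proj j : EuclideanSpace ℂ (Fin 3) →L[ℂ] ℂ) ((w' t : (Fin 3 → ℤ) → EuclideanSpace ℂ (Fin 3)) k)))
            (_hw'div : ∀ t ∈ Ioo 0 T, ∀ k : Fin 3 → ℤ,
              ∑ j, ((k j : ℤ) : ℂ) * (EuclideanSpace.proj j : EuclideanSpace ℂ (Fin 3) →L[ℂ] ℂ)
                ((w' t : (Fin 3 → ℤ) → EuclideanSpace ℂ (Fin 3)) k) = 0),
            EqOn w' w (Icc 0 T) := by
  obtain ⟨v, hv1, hvr, hvP, hvreal, hvdiv, hAv, H⟩ := exists_keep_solution_abc_final K A B C hν hμ heig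
  refine ⟨v, hv1, hvr, hvP, hvreal, hvdiv, hAv, ?_⟩
  intro T hT ε hε μt G₁ G₂ G hG₁ hG₂ hG hG₁P hG₂P hGP hG₁pos ω c m₂ M₁ hc hm₂ hM₁ hm₂' hM₁' m M ω₁ hm0 hm hM h₁ h₂
    hL hμ₁ hμ₂ htail hgap C' hCC' hsmall
  -- THE smooth solution (core) and the floor (part XVIII) — identified by uniqueness in the class
  obtain ⟨w, hw, hw0, hw', hsm, ⟨Cw, hCw, hwdec⟩, hwfix, hwreal, hwdiv, huniq⟩ :=
    keep_smooth_of_eigenvector K A B C hν hμ hv1 hvr hvP hvreal hvdiv hAv hT hε hG₁ hG₂ hG hG₁P hG₂P hGP hG₁pos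
      hc hm₂ hM₁ hm₂' hM₁' hm0 hm hM h₁ h₂ hL hμ₁ hμ₂ htail hgap hCC' hsmall
  obtain ⟨w₁, -, -, -, -, -, -, -, hfloor₁, huniq₁⟩ := H hT hε hG₁ hG₂ hG hG₁P hG₂P hGP hG₁pos hc hm₂ hM₁ hm₂'
    hM₁' hm0 hm hM h₁ h₂ hL hμ₁ hμ₂ htail hgap hCC' hsmall
  have heq : EqOn w w₁ (Icc 0 T) := huniq₁ hw hw0 hw' hCw hwdec hwfix hwreal hwdiv
  exact ⟨w, hw, hw0, hw', hsm, ⟨Cw, hCw, hwdec⟩, hwfix, hwreal, hwdiv,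
    fun t ht hχ => by rw [heq ht]; exact hfloor₁ t ht hχ, huniq⟩

end Summit.NavierStokesRegularity.FluidComputer.TransportGalerkinAbcSmoothKeep

end
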